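import Summits.AtomisticToContinuum.Crystallization.Theorems.ChartedZeroExcessLayeredLatticeLiouvilleZV

/-!
# Part ZW «Propagation of cap-type and the window dichotomy» (lens-2 g79, NODE 79 rider 6 = LEMMA D of the (L2-C⟂′T) blueprint; imports ZV)

For a map `g` between two Barlow graphs that is a link map (Part ZV) at a vertex `x` AND at the neighbours of `x`:

* `CapType.of_up` / `CapType.of_lo` ★ (M2) — a cross neighbour `x″` of a cap-type vertex `x` is cap-type: the triangle of `x″` on the side of `x` consists
  of `x` and two sheet neighbours of `x` (`linkPt_up_lo`, `linkPt_lo_up`; finite), whose images lie in the layer of `g x` (`CapType.inLayer`), i.e. in ONE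
  cap of `g x″` (`CapType.sides` fixes the side); Part ZU's F3 then puts the other triangle of `x″` into the other cap;
* `CapType.of_sheet` ★ (M1) — a sheet neighbour `x'` of a cap-type `x` is cap-type: `x'` is a lower cross neighbour of an upper cross neighbour of `x`
  (`exists_common_up`; finite), so M2 twice;
* `CapType.of_barlowAdj`, `CapType.of_reflTransGen` ★ — cap-type spreads along Barlow paths inside any set `W` on and next to which `g` is a link map;
* `allC_of_not_capType` ★ — THE DICHOTOMY: on a Barlow-connected window EITHER every vertex is cap-type (sheets ↦ sheets: regime (L2-C⟂′∥)) OR every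
  image vertex is a c-vertex of `B_τ'` (the target crystal is all-`c`, fcc-like, on the window: regime (L2-C⟂′T)) — by `IsLinkMap.capType_or_c`.

Pure combinatorics; no door-set hypothesis enters.  0 sorry.
-/

namespace Summit.AtomisticToContinuum.Crystallization.Theorems.ChartedZeroExcessLayeredLatticeLiouville

/-! ## ZW-1  Second-generation link sites: the cross neighbour's lower triangle, the common cross neighbour -/

/-- finite core: a lower-cap site of an upper-cap site of `x` is `x` or a sheet neighbour of `x`. [formal bookkeeping] -/
theorem linkSite_up_lo (α β γ : Bool) (i₀ j : Fin 12) (hi₀ : 6 ≤ i₀.val) (hi₀' : i₀.val ≤ 8) (hj : 9 ≤ j.val) :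
    linkSite α β i₀ + linkSite β γ j = 0 ∨ ∃ k : Fin 12, k.val < 6 ∧ linkSite α β i₀ + linkSite β γ j = linkSite α β k := by
  revert hi₀ hi₀' hj; revert α β γ i₀ j; decide

/-- finite core: an upper-cap site of a lower-cap site of `x` is `x` or a sheet neighbour of `x`. [formal bookkeeping] -/
theorem linkSite_lo_up (δ α β : Bool) (i₀ j : Fin 12) (hi₀ : 9 ≤ i₀.val) (hj : 6 ≤ j.val) (hj' : j.val ≤ 8) :
    linkSite α β i₀ + linkSite δ α j = 0 ∨ ∃ k : Fin 12, k.val < 6 ∧ linkSite α β i₀ + linkSite δ α j = linkSite α β k := by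
  revert hi₀ hj hj'; revert δ α β i₀ j; decide

/-- finite core: every sheet neighbour of `x` is a lower-cap site of some upper-cap site of `x` (a common cross neighbour). [formal bookkeeping] -/
theorem linkSite_common_up (α β γ : Bool) (k : Fin 12) (hk : k.val < 6) :
    ∃ i₀ : Fin 12, 6 ≤ i₀.val ∧ i₀.val ≤ 8 ∧ ∃ j : Fin 12, 9 ≤ j.val ∧ linkSite α β i₀ + linkSite β γ j = linkSite α β k := by
  revert hk; revert α β γ k; decide

/-- composition of two link steps. [formal bookkeeping] -/
theorem linkPt_linkPt (τ : ℤ → Bool) (x : ℤ × ℤ × ℤ) (i₀ j : Fin 12) : linkPt τ (linkPt τ x i₀) j =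
    shiftSite x (linkSite (τ (x.1 - 1)) (τ x.1) i₀ + linkSite (τ ((linkPt τ x i₀).1 - 1)) (τ (linkPt τ x i₀).1) j) := by
  simp only [linkPt, shiftSite, Prod.fst_add, Prod.snd_add, add_assoc]

/-- the lower triangle of an upper cross neighbour `x″` of `x` consists of `x` and two sheet neighbours of `x`. [this file, g79] -/
theorem linkPt_up_lo (τ : ℤ → Bool) (x : ℤ × ℤ × ℤ) (i₀ j : Fin 12) (hi₀ : 6 ≤ i₀.val) (hi₀' : i₀.val ≤ 8) (hj : 9 ≤ j.val) :
    linkPt τ (linkPt τ x i₀) j = x ∨ ∃ k : Fin 12, k.val < 6 ∧ linkPt τ (linkPt τ x i₀) j = linkPt τ x k := by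
  have h1 : (linkPt τ x i₀).1 = x.1 + 1 := by rw [linkPt_fst, (linkSite_fst_eq_one_iff _ _ i₀).2 ⟨hi₀, hi₀'⟩]
  rw [linkPt_linkPt, h1, show x.1 + 1 - 1 = x.1 by ring]
  rcases linkSite_up_lo (τ (x.1 - 1)) (τ x.1) (τ (x.1 + 1)) i₀ j hi₀ hi₀' hj with h0 | ⟨k, hk, hkk⟩
  · left; rw [h0]; simp [shiftSite]
  · exact Or.inr ⟨k, hk, by rw [hkk]; rfl⟩

/-- the upper triangle of a lower cross neighbour `x″` of `x` consists of `x` and two sheet neighbours of `x`. [this file, g79] -/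
theorem linkPt_lo_up (τ : ℤ → Bool) (x : ℤ × ℤ × ℤ) (i₀ j : Fin 12) (hi₀ : 9 ≤ i₀.val) (hj : 6 ≤ j.val) (hj' : j.val ≤ 8) :
    linkPt τ (linkPt τ x i₀) j = x ∨ ∃ k : Fin 12, k.val < 6 ∧ linkPt τ (linkPt τ x i₀) j = linkPt τ x k := by
  have h1 : (linkPt τ x i₀).1 = x.1 - 1 := by rw [linkPt_fst, (linkSite_fst_eq_neg_one_iff _ _ i₀).2 hi₀]; ring
  rw [linkPt_linkPt, h1]
  rcases linkSite_lo_up (τ (x.1 - 1 - 1)) (τ (x.1 - 1)) (τ x.1) i₀ j hi₀ hj hj' with h0 | ⟨k, hk, hkk⟩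
  · left; rw [h0]; simp [shiftSite]
  · exact Or.inr ⟨k, hk, by rw [hkk]; rfl⟩

/-- every sheet neighbour `x'` of `x` is a lower cross neighbour of an upper cross neighbour of `x`. [this file, g79] -/
theorem exists_common_up (τ : ℤ → Bool) (x : ℤ × ℤ × ℤ) (k : Fin 12) (hk : k.val < 6) :
    ∃ i₀ : Fin 12, 6 ≤ i₀.val ∧ i₀.val ≤ 8 ∧ ∃ j : Fin 12, 9 ≤ j.val ∧ linkPt τ (linkPt τ x i₀) j = linkPt τ x k := by
  obtain ⟨i₀, hi₀, hi₀', j, hj, e⟩ := linkSite_common_up (τ (x.1 - 1)) (τ x.1) (τ (x.1 + 1)) k hk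
  have h1 : (linkPt τ x i₀).1 = x.1 + 1 := by rw [linkPt_fst, (linkSite_fst_eq_one_iff _ _ i₀).2 ⟨hi₀, hi₀'⟩]
  refine ⟨i₀, hi₀, hi₀', j, hj, ?_⟩
  rw [linkPt_linkPt, h1, show x.1 + 1 - 1 = x.1 by ring, e]; rfl

/-! ## ZW-2  ★ PROPAGATION of cap-type (LEMMA D of the blueprint): M2 across layers, M1 within the sheet -/

/-- ★ (M2, upward) an upper cross neighbour of a cap-type vertex is cap-type. [this file, g79] -/
theorem CapType.of_up {τ τ' : ℤ → Bool} {g : ℤ × ℤ × ℤ → ℤ × ℤ × ℤ} {x : ℤ × ℤ × ℤ} (hcap : CapType τ g x) (hx : IsLinkMap τ τ' g x)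
    {i₀ : Fin 12} (hi₀ : 6 ≤ i₀.val) (hi₀' : i₀.val ≤ 8) (hx₂ : IsLinkMap τ τ' g (linkPt τ x i₀)) : CapType τ g (linkPt τ x i₀) := by
  obtain ⟨c, hI, hc⟩ := hx₂.exists_codeIso
  rw [capType_iff_codes hc]
  have one := linkSite_fst_eq_one_iff (τ' ((g (linkPt τ x i₀)).1 - 1)) (τ' (g (linkPt τ x i₀)).1)
  have neg := linkSite_fst_eq_neg_one_iff (τ' ((g (linkPt τ x i₀)).1 - 1)) (τ' (g (linkPt τ x i₀)).1)
  have hlo_layer : ∀ j : Fin 12, 9 ≤ j.val → (g (linkPt τ (linkPt τ x i₀) j)).1 = (g x).1 := by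
    intro j hj
    rcases linkPt_up_lo τ x i₀ j hi₀ hi₀' hj with h0 | ⟨k, hk, hkk⟩
    · rw [h0]
    · rw [hkk]; exact hcap.inLayer hx k hk
  rcases hcap.sides hx with ⟨hu, -⟩ | ⟨hu, -⟩
  · have e : (g (linkPt τ x i₀)).1 = (g x).1 + 1 := hu i₀ hi₀ hi₀'
    have hlo : ∀ j : Fin 12, 9 ≤ j.val → 9 ≤ (c j).val := by
      intro j hj
      have h := hlo_layer j hj
      rw [hc j, linkPt_fst] at h
      exact (neg (c j)).1 (by linarith)
    intro i hi
    rcases Nat.lt_or_ge i.val 9 with hi' | hi'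
    · exact (hI.up_of_lo_lo hlo i hi (by omega)).1
    · exact le_trans (by norm_num) (hlo i hi')
  · have e : (g (linkPt τ x i₀)).1 = (g x).1 - 1 := hu i₀ hi₀ hi₀'
    have hlo : ∀ j : Fin 12, 9 ≤ j.val → 6 ≤ (c j).val ∧ (c j).val ≤ 8 := by
      intro j hj
      have h := hlo_layer j hj
      rw [hc j, linkPt_fst] at h
      exact (one (c j)).1 (by linarith)
    intro i hi
    rcases Nat.lt_or_ge i.val 9 with hi' | hi'
    · exact le_trans (by norm_num) (hI.lo_of_lo_up hlo i hi (by omega))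
    · exact (hlo i hi').1

/-- ★ (M2, downward) a lower cross neighbour of a cap-type vertex is cap-type. [this file, g79] -/
theorem CapType.of_lo {τ τ' : ℤ → Bool} {g : ℤ × ℤ × ℤ → ℤ × ℤ × ℤ} {x : ℤ × ℤ × ℤ} (hcap : CapType τ g x) (hx : IsLinkMap τ τ' g x)
    {i₀ : Fin 12} (hi₀ : 9 ≤ i₀.val) (hx₂ : IsLinkMap τ τ' g (linkPt τ x i₀)) : CapType τ g (linkPt τ x i₀) := by
  obtain ⟨c, hI, hc⟩ := hx₂.exists_codeIso
  rw [capType_iff_codes hc]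
  have one := linkSite_fst_eq_one_iff (τ' ((g (linkPt τ x i₀)).1 - 1)) (τ' (g (linkPt τ x i₀)).1)
  have neg := linkSite_fst_eq_neg_one_iff (τ' ((g (linkPt τ x i₀)).1 - 1)) (τ' (g (linkPt τ x i₀)).1)
  have hup_layer : ∀ j : Fin 12, 6 ≤ j.val → j.val ≤ 8 → (g (linkPt τ (linkPt τ x i₀) j)).1 = (g x).1 := by
    intro j hj hj'
    rcases linkPt_lo_up τ x i₀ j hi₀ hj hj' with h0 | ⟨k, hk, hkk⟩
    · rw [h0]
    · rw [hkk]; exact hcap.inLayer hx k hk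
  rcases hcap.sides hx with ⟨-, hl⟩ | ⟨-, hl⟩
  · have e : (g (linkPt τ x i₀)).1 = (g x).1 - 1 := hl i₀ hi₀
    have hup : ∀ j : Fin 12, 6 ≤ j.val → j.val ≤ 8 → 6 ≤ (c j).val ∧ (c j).val ≤ 8 := by
      intro j hj hj'
      have h := hup_layer j hj hj'
      rw [hc j, linkPt_fst] at h
      exact (one (c j)).1 (by linarith)
    intro i hi
    rcases Nat.lt_or_ge i.val 9 with hi' | hi'
    · exact (hup i hi (by omega)).1
    · exact le_trans (by norm_num) (hI.lo_of_up_up hup i hi')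
  · have e : (g (linkPt τ x i₀)).1 = (g x).1 + 1 := hl i₀ hi₀
    have hup : ∀ j : Fin 12, 6 ≤ j.val → j.val ≤ 8 → 9 ≤ (c j).val := by
      intro j hj hj'
      have h := hup_layer j hj hj'
      rw [hc j, linkPt_fst] at h
      exact (neg (c j)).1 (by linarith)
    intro i hi
    rcases Nat.lt_or_ge i.val 9 with hi' | hi'
    · exact le_trans (by norm_num) (hup i hi (by omega))
    · exact (hI.up_of_up_lo hup i hi').1

/-- ★ (M1) a sheet neighbour of a cap-type vertex is cap-type — via the common upper cross neighbour (M2 twice). [this file, g79] -/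
theorem CapType.of_sheet {τ τ' : ℤ → Bool} {g : ℤ × ℤ × ℤ → ℤ × ℤ × ℤ} {x : ℤ × ℤ × ℤ} (hcap : CapType τ g x) (hx : IsLinkMap τ τ' g x)
    (hnb : ∀ i, IsLinkMap τ τ' g (linkPt τ x i)) {k : Fin 12} (hk : k.val < 6) : CapType τ g (linkPt τ x k) := by
  obtain ⟨i₀, hi₀, hi₀', j, hj, e⟩ := exists_common_up τ x k hk
  have h1 : CapType τ g (linkPt τ x i₀) := hcap.of_up hx hi₀ hi₀' (hnb i₀)
  have h2 : IsLinkMap τ τ' g (linkPt τ (linkPt τ x i₀) j) := by rw [e]; exact hnb k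
  have h3 := h1.of_lo (hnb i₀) hj h2
  rwa [e] at h3

/-- ★ PROPAGATION: cap-type spreads from a vertex to ALL its neighbours (given link maps at the vertex and at its neighbours). Consequence on a connected window
(used in g80): either EVERY vertex is cap-type — the map preserves sheets, regime (L2-C⟂′∥) — or NO vertex is, and then by `IsLinkMap.capType_or_c` every
image is a c-vertex, i.e. the target crystal is all-`c` (fcc-like) on the window, regime (L2-C⟂′T). [this file, g79] -/
theorem CapType.of_barlowAdj {τ τ' : ℤ → Bool} {g : ℤ × ℤ × ℤ → ℤ × ℤ × ℤ} {x y : ℤ × ℤ × ℤ} (hcap : CapType τ g x)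
    (hx : IsLinkMap τ τ' g x)
    (hnb : ∀ i, IsLinkMap τ τ' g (linkPt τ x i)) (hy : BarlowAdj τ x y) : CapType τ g y := by
  obtain ⟨i, rfl⟩ := exists_linkPt_of_barlowAdj hy
  rcases Nat.lt_or_ge i.val 6 with hi | hi
  · exact hcap.of_sheet hx hnb hi
  rcases Nat.lt_or_ge i.val 9 with hi' | hi'
  · exact hcap.of_up hx hi (by omega) (hnb i)
  · exact hcap.of_lo hx hi' (hnb i)

/-! ## ZW-3  The window dichotomy -/

/-- ★ cap-type is constant along Barlow paths inside a set `W` on which (and next to which) `g` is a link map. [this file, g79] -/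
theorem CapType.of_reflTransGen {τ τ' : ℤ → Bool} {g : ℤ × ℤ × ℤ → ℤ × ℤ × ℤ} {W : Set (ℤ × ℤ × ℤ)}
    (hmaps : ∀ z ∈ W, IsLinkMap τ τ' g z) (hnb : ∀ z ∈ W, ∀ i, IsLinkMap τ τ' g (linkPt τ z i)) {x y : ℤ × ℤ × ℤ}
    (h : Relation.ReflTransGen (fun a b => a ∈ W ∧ b ∈ W ∧ BarlowAdj τ a b) x y) (hx : CapType τ g x) : CapType τ g y := by
  induction h with
  | refl => exact hx
  | tail _ hbc ih => exact ih.of_barlowAdj (hmaps _ hbc.1) (hnb _ hbc.1) hbc.2.2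

/-- ★ THE DICHOTOMY, second branch: if some vertex Barlow-reachable inside `W` from `y` is NOT cap-type, then the image of `y` is a c-vertex of `B_τ'`. Hence on a
Barlow-connected window either every vertex is cap-type (sheets go to sheets: regime (L2-C⟂′∥)) or every image vertex is a c-vertex (the target is
all-`c` = fcc-like there: regime (L2-C⟂′T)). [this file, g79] -/
theorem allC_of_not_capType {τ τ' : ℤ → Bool} {g : ℤ × ℤ × ℤ → ℤ × ℤ × ℤ} {W : Set (ℤ × ℤ × ℤ)}
    (hmaps : ∀ z ∈ W, IsLinkMap τ τ' g z) (hnb : ∀ z ∈ W, ∀ i, IsLinkMap τ τ' g (linkPt τ z i)) {x y : ℤ × ℤ × ℤ} (hy : y ∈ W)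
    (h : Relation.ReflTransGen (fun a b => a ∈ W ∧ b ∈ W ∧ BarlowAdj τ a b) y x) (hx : ¬ CapType τ g x) : τ' ((g y).1 - 1) = τ' (g y).1 := by
  rcases (hmaps y hy).capType_or_c with hc | hc
  · exact absurd (hc.of_reflTransGen hmaps hnb h) hx
  · exact hc

end Summit.AtomisticToContinuum.Crystallization.Theorems.ChartedZeroExcessLayeredLatticeLiouville
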